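import Summits.ResolutionOfSingularities.ResolutionOfSingularities.Theorems.MarkedTransferCampaignW46MohWindowShadeAdapted
import Summits.ResolutionOfSingularities.ResolutionOfSingularities.Theorems.MarkedTransferCampaignW46MohWindowShadePSBaseChange
import Mathlib.FieldTheory.Separable
import HarnessLib

/-!
# [OURS · L1 W4.6 rung (iii)] THE DEGREE LAW of the shade model: at an equimultiple translated point of RESIDUE DEGREE `m` inside the
# window, `m · shade′ ≤ shade` — a point blown up with residue field of degree `m ≥ 2` over the current coefficient field divides the
# shade by at least `m` (surfaces; polynomial and power-series residuals)

Cell `res-hironaka`, LADDER-RESOLUTION rung L (D-0089), slot W4.6 rung (iii) «purely inseparable `z^p = f(x, y)` with `ord f < 2p`»; seat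
res-L1-s46-pv-6 (gen 7). Host route MarkedTransfer, `--supports stmt-ResolutionOfSingularities-16155 --as helper`; kind proof (no
definition). OURS: a theorem about the classical characteristic-`p` model of [Hauser2010, §§F–G] as typed in the tree (`PointBlowup.State/step/shade`)
and its power-series port (`MohWindowShadePS.Series`, p540070); NOT a statement of the manuscript [claim: Hironaka2017, status: under-review],
nothing of which is used. AI-written; AI review is weaker than expert review.

## Statement (`degree_mul_shade_step_le`, polynomial; `series_degree_mul_shade_step_le`, series)

Two residual letters `σ = {j, i}`, a state `(F, r)` with `F = F₀ ⊗_{K₀} K` defined over a subfield (`F₀ ∈ K₀[y]`, `ι : K₀ → K`), cleaned or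
not, `y^r ∣ F`, order `o` with `p < o < 2p`, and a TRANSLATED point `b = t e_i` of the chart `y_j` (`t ≠ 0`) which is EQUIMULTIPLE; let `t` be a
root of `π^ι` for an irreducible separable `π ∈ K₀[X]` of degree `m` (the minimal polynomial of the point over `K₀`: the point has residue
degree `m`). Then `m · shade′ ≤ shade` and `shade ≥ 1`. In particular a stall (`shade′ = shade`) forces `m = 1`: inside the window, a thread
of singular points of the typed procedure whose shade has stopped dropping passes only through points RATIONAL over the current coefficient
field (`…FormalNRWalk`). Proof: gen 2's Hasse test (`MohWindowShadeHasse.shade_step_le_of_hasse_ne_zero_two_vars`) bounds `shade′` by the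
multiplicity `k` of `t` as a root of the dehomogenised initial form `P(y) = Σ_{|d| = o} c_d y^{d_i} = y^{r_i} · G_a(1, y)` (`a` = shade,
`deg G_a(1, ·) ≤ a`; the `k`-th Taylor coefficient at a root of multiplicity `k` is non-zero); `P ∈ K₀[y]`, so `(π^ι)^k · y^{r_i} ∣ P`
(`π` separable, coprime to `y`), whence `m k ≤ a`; and equimultiplicity makes `P(t) = 0`, so `P ≠ c y^{r_i}`, `a ≥ 1`.
References: H. Hauser, Bull. AMS 47 (2010) §§F–G; H. Hauser, D. Wagner, Algebra Number Theory 8 (2014) §5 (translational moves).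
[Hauser2010] [HauserWagner2014] [folklore]
-/

noncomputable section

set_option linter.dupNamespace false -- mandated namespace of this single-conjunct summit

open MvPolynomial Finset

open scoped BigOperators

namespace Summit.ResolutionOfSingularities.ResolutionOfSingularities.Theorems.CampaignW46

namespace MohWindowShadeDegreeLaw

open Literature.AlgebraicGeometry.Resolution
open Literature.AlgebraicGeometry.Resolution.PointBlowup
open Literature.AlgebraicGeometry.Resolution.Hauser2010
open MohWindowShadeCleaning (eq_single_add_single degree_eq_add)
open MohWindowShadeAdapted (taylor_coeff_sum_C_mul_X_pow)

/-! ## §1 One-variable algebra: powers of the minimal polynomial divide -/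

section Minimal

variable {K₀ K : Type*} [Field K₀] [Field K] (ι : K₀ →+* K)

/-- **A polynomial over `K₀` vanishing to order `k` at a root `t ∈ K` of the irreducible separable `π ∈ K₀[X]` is divisible by `(π^ι)^k`.**
[folklore] -/
theorem pow_dvd_map_of_rootMultiplicity {π : Polynomial K₀} (hirr : Irreducible π) (hsep : π.Separable) {t : K} (ht : (π.map ι).IsRoot t) :
    ∀ (n : ℕ) (Q : Polynomial K₀), Q.natDegree ≤ n → (π.map ι) ^ Polynomial.rootMultiplicity t (Q.map ι) ∣ Q.map ι := by
  classical
  have hπt : Polynomial.rootMultiplicity t (π.map ι) = 1 := by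
    apply le_antisymm
    · rw [← Polynomial.count_roots]; exact Polynomial.count_roots_le_one (hsep.map) t
    · exact (Polynomial.rootMultiplicity_pos (Polynomial.map_ne_zero hirr.ne_zero)).mpr ht
  intro n
  induction n with
  | zero =>
    intro Q hQ
    by_cases hQ0 : Q.map ι = 0
    · rw [hQ0]; exact dvd_zero _
    · have hc : Q = Polynomial.C (Q.coeff 0) := Polynomial.eq_C_of_natDegree_le_zero hQ
      have hroot : ¬ (Q.map ι).IsRoot t := by
        rw [hc, Polynomial.map_C, Polynomial.IsRoot, Polynomial.eval_C]
        intro h0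
        apply hQ0
        rw [hc, Polynomial.map_C, h0, map_zero]
      rw [Polynomial.rootMultiplicity_eq_zero hroot, pow_zero]
      exact one_dvd _
  | succ n ih =>
    intro Q hQ
    by_cases hroot : (Q.map ι).IsRoot t
    · -- `π ∣ Q`
      have hdvd : π ∣ Q := by
        by_contra hnd
        have hcop : IsCoprime π Q := (hirr.coprime_iff_not_dvd).mpr hnd
        obtain ⟨u, v, huv⟩ := hcop
        have h1 := congrArg (fun q : Polynomial K₀ => (q.map ι).eval t) huv
        simp only [Polynomial.map_add, Polynomial.map_mul, Polynomial.map_one, Polynomial.eval_add, Polynomial.eval_mul, Polynomial.eval_one] at h1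
        rw [ht.eq_zero, hroot.eq_zero, mul_zero, mul_zero, add_zero] at h1
        exact zero_ne_one h1
      obtain ⟨Q₁, rfl⟩ := hdvd
      by_cases hQ₁0 : Q₁ = 0
      · subst hQ₁0; rw [mul_zero, Polynomial.map_zero]; exact dvd_zero _
      have hQ0 : (π * Q₁).map ι ≠ 0 := by
        rw [Polynomial.map_mul]
        exact mul_ne_zero (Polynomial.map_ne_zero hirr.ne_zero) (Polynomial.map_ne_zero hQ₁0)
      have hdegQ₁ : Q₁.natDegree ≤ n := by
        have h1 : (π * Q₁).natDegree = π.natDegree + Q₁.natDegree := Polynomial.natDegree_mul hirr.ne_zero hQ₁0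
        have h2 : 1 ≤ π.natDegree := Polynomial.natDegree_pos_iff_degree_pos.mpr (Polynomial.degree_pos_of_irreducible hirr)
        omega
      rw [Polynomial.map_mul, Polynomial.rootMultiplicity_mul (by rw [← Polynomial.map_mul]; exact hQ0), hπt, pow_add, pow_one]
      exact mul_dvd_mul_left _ (ih Q₁ hdegQ₁)
    · rw [Polynomial.rootMultiplicity_eq_zero hroot, pow_zero]; exact one_dvd _

end Minimal

/-! ## §2 The degree law (polynomial residuals, surfaces) -/

section Poly

variable {σ : Type*} {K : Type*} [Field K] [Fintype σ] [DecidableEq σ] [DecidableEq K]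
variable (p : ℕ) [hp : Fact p.Prime] [CharP K p] {j i : σ}

omit hp [CharP K p] in
/-- **[OURS · L1 W4.6] THE DEGREE LAW, polynomial residuals.** See the module docstring. [cite: Hauser2010, §§F–G (point blowup followed by cleaning)] -/
theorem degree_mul_shade_step_le (hij : i ≠ j) (htwo : ∀ l, l = j ∨ l = i) (b : σ → K) (hbj : b j = 0) (hbi : b i ≠ 0) (s : State σ K)
    {o : ℕ} (ho : ordZero s.F = o) (hlo : p < o) (hhi : o < 2 * p) (hr : ∀ d ∈ s.F.support, s.r ≤ d) (heq : IsEquimultiplePoint p j b s)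
    {K₀ : Type*} [Field K₀] (ι : K₀ →+* K) (F₀ : MvPolynomial σ K₀) (hF : s.F = MvPolynomial.map ι F₀)
    {π : Polynomial K₀} (hirr : Irreducible π) (hsep : π.Separable) (ht : (π.map ι).IsRoot (b i)) :
    (π.natDegree : ℕ∞) * (step p j b s).shade ≤ s.shade ∧ 1 ≤ s.shade := by
  classical
  obtain ⟨⟨d₀, hd₀, hd₀deg⟩, -⟩ := (ordZero_eq_nat_iff _ _).mp ho
  have hd₀s : d₀ ∈ s.F.support := MvPolynomial.mem_support_iff.mpr hd₀
  set a := o - s.r.degree with ha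
  have hshade : s.shade = (a : ℕ∞) := shade_eq_of_ordZero_eq s ho
  -- the dehomogenised initial form `P` and its `K₀`-form `P₀`
  set P : Polynomial K := ∑ d ∈ s.F.support with d.degree = o, Polynomial.C (coeff d s.F) * Polynomial.X ^ (d i) with hP
  set P₀ : Polynomial K₀ := ∑ d ∈ F₀.support with d.degree = o, Polynomial.C (coeff d F₀) * Polynomial.X ^ (d i) with hP₀
  have hsupp : s.F.support = F₀.support := by rw [hF]; exact MvPolynomial.support_map_of_injective F₀ ι.injective
  have hPmap : P = P₀.map ι := by
    rw [hP, hP₀, Polynomial.map_sum, hsupp]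
    refine Finset.sum_congr rfl fun d _ => ?_
    rw [Polynomial.map_mul, Polynomial.map_C, Polynomial.map_pow, Polynomial.map_X, hF, coeff_map]
  -- `P ≠ 0`, `y^{r_i} ∣ P`, `deg P ≤ r_i + a`
  have hPne : P ≠ 0 := by
    intro h0
    have hc : P.coeff (d₀ i) = coeff d₀ s.F := by
      rw [hP, Polynomial.finsetSum_coeff, Finset.sum_eq_single d₀]
      · rw [Polynomial.coeff_C_mul_X_pow, if_pos rfl]
      · intro d hd hne'
        rw [Polynomial.coeff_C_mul_X_pow, if_neg]
        intro heq'
        apply hne'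
        obtain ⟨-, hdo⟩ := Finset.mem_filter.mp hd
        have h1 := degree_eq_add hij htwo d
        have h2 := degree_eq_add hij htwo d₀
        have hdj : d j = d₀ j := by omega
        rw [eq_single_add_single hij htwo d, eq_single_add_single hij htwo d₀, hdj, heq']
      · intro h; exact absurd (Finset.mem_filter.mpr ⟨hd₀s, hd₀deg⟩) h
    rw [h0, Polynomial.coeff_zero] at hc
    exact hd₀ hc.symm
  have hX0 : Polynomial.X ^ (s.r i) ∣ P := by
    rw [hP]
    refine Finset.dvd_sum fun d hd => ?_
    obtain ⟨hds, -⟩ := Finset.mem_filter.mp hd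
    exact dvd_mul_of_dvd_right (pow_dvd_pow _ (Finsupp.le_def.mp (hr d hds) i)) _
  have hdegP : P.natDegree ≤ s.r i + a := by
    rw [hP]
    refine Polynomial.natDegree_sum_le_of_forall_le _ _ fun d hd => ?_
    refine le_trans (Polynomial.natDegree_C_mul_X_pow_le _ _) ?_
    obtain ⟨hds, hdo⟩ := Finset.mem_filter.mp hd
    have h1 := degree_eq_add hij htwo d
    have h2 := degree_eq_add hij htwo s.r
    have h3 : s.r j ≤ d j := Finsupp.le_def.mp (hr d hds) j
    have h4 : s.r.degree ≤ o := hd₀deg ▸ degree_le_degree_of_le (hr d₀ hd₀s)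
    omega
  -- the multiplicity `k` of `t` and the Hasse coefficient `λ_k ≠ 0`
  set k := Polynomial.rootMultiplicity (b i) P with hk
  have hlam : ∑ d ∈ s.F.support with d.degree = o, coeff d s.F * (((d i).choose k : K) * b i ^ (d i - k)) ≠ 0 := by
    rw [← taylor_coeff_sum_C_mul_X_pow, ← hP]
    have h1 : k = (Polynomial.taylor (b i) P).natTrailingDegree := by
      rw [hk, Polynomial.rootMultiplicity_eq_natTrailingDegree, Polynomial.taylor_apply]
    rw [h1]
    exact Polynomial.trailingCoeff_nonzero_iff_nonzero.mpr ((Polynomial.taylor_injective (b i)).ne hPne |> fun h => by rwa [map_zero] at h)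
  have hstep : (step p j b s).shade ≤ (k : ℕ∞) := MohWindowShadeHasse.shade_step_le_of_hasse_ne_zero_two_vars p hij htwo b hbj hbi s ho hlo hhi k hlam
  -- `(π^ι)^k · y^{r_i} ∣ P`, so `m k ≤ a`
  have hπk : (π.map ι) ^ k ∣ P := by
    have h := pow_dvd_map_of_rootMultiplicity ι hirr hsep ht P₀.natDegree P₀ le_rfl
    rwa [← hPmap] at h
  have hcop : IsCoprime (Polynomial.X ^ (s.r i) : Polynomial K) ((π.map ι) ^ k) := by
    refine IsCoprime.pow ?_
    refine (Polynomial.irreducible_X.coprime_iff_not_dvd).mpr fun hX => ?_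
    have h0 : (π.map ι).eval 0 = 0 := by
      obtain ⟨q, hq⟩ := hX; rw [hq, Polynomial.eval_mul, Polynomial.eval_X, zero_mul]
    -- then `0` and `t ≠ 0` are both roots of the irreducible `π`: `π = X`, contradiction
    have hXd : (Polynomial.X : Polynomial K₀) ∣ π := by
      rw [Polynomial.X_dvd_iff]
      have : ι (π.coeff 0) = 0 := by rwa [← Polynomial.coeff_zero_eq_eval_zero, Polynomial.coeff_map] at h0
      exact (map_eq_zero_iff ι ι.injective).mp this
    obtain ⟨q, hq⟩ := hXd
    have hqu : IsUnit q := by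
      rcases hirr.isUnit_or_isUnit hq with h | h
      · exact absurd h Polynomial.not_isUnit_X
      · exact h
    obtain ⟨c, hc⟩ := Polynomial.isUnit_iff.mp hqu
    have ht0 := ht.eq_zero
    rw [hq, ← hc.2, Polynomial.map_mul, Polynomial.map_X, Polynomial.map_C, Polynomial.eval_mul, Polynomial.eval_X, Polynomial.eval_C] at ht0
    rcases mul_eq_zero.mp ht0 with h | h
    · exact hbi h
    · exact hc.1.ne_zero ((map_eq_zero_iff ι ι.injective).mp h)
  have hprod : Polynomial.X ^ (s.r i) * (π.map ι) ^ k ∣ P := hcop.mul_dvd hX0 hπk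
  have hmk : π.natDegree * k ≤ a := by
    have h1 := Polynomial.natDegree_le_of_dvd hprod hPne
    rw [Polynomial.natDegree_mul (pow_ne_zero _ Polynomial.X_ne_zero) (pow_ne_zero _ (Polynomial.map_ne_zero hirr.ne_zero)),
      Polynomial.natDegree_pow, Polynomial.natDegree_X, mul_one, Polynomial.natDegree_pow, Polynomial.natDegree_map, Nat.mul_comm] at h1
    omega
  -- equimultiplicity: `P(t) = λ_0 = 0`, so `k ≥ 1` and `a ≥ 1`
  have hlam0 : ∑ d ∈ s.F.support with d.degree = o, coeff d s.F * (((d i).choose 0 : K) * b i ^ (d i - 0)) = 0 := by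
    set E : σ →₀ ℕ := Finsupp.single j (o - p) with hE
    have hEj : E j = o - p := by simp [hE]
    have hEi : E i = 0 := by simp [hE, hij]
    have herase : (Finset.univ : Finset σ).erase j = {i} := by
      ext l
      rw [Finset.mem_erase, Finset.mem_singleton]
      constructor
      · rintro ⟨hlj, -⟩
        rcases htwo l with h | h
        · exact absurd h hlj
        · exact h
      · intro h; rw [h]; exact ⟨hij, Finset.mem_univ i⟩
    have h1 := MohWindowShadeHasse.coeff_pointTransform_layer p j b hbj s ho hlo.le E hEj
    simp_rw [herase, Finset.prod_singleton, hEi] at h1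
    rw [← h1]
    refine heq E ?_ ?_
    · intro h0; have := congrArg (fun f => f j) h0; simp [hEj] at this; omega
    · rw [degree_eq_add hij htwo E, hEj, hEi]; omega
  have hk1 : 1 ≤ k := by
    rw [hk]
    refine (Polynomial.rootMultiplicity_pos hPne).mpr ?_
    rw [Polynomial.IsRoot, ← Polynomial.taylor_coeff_zero, hP, taylor_coeff_sum_C_mul_X_pow]
    exact hlam0
  refine ⟨?_, ?_⟩
  · rw [hshade]
    calc (π.natDegree : ℕ∞) * (step p j b s).shade ≤ (π.natDegree : ℕ∞) * (k : ℕ∞) := mul_le_mul_right hstep _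
      _ ≤ (a : ℕ∞) := by exact_mod_cast hmk
  · rw [hshade]
    have hm1 : 1 ≤ π.natDegree := Polynomial.natDegree_pos_iff_degree_pos.mpr (Polynomial.degree_pos_of_irreducible hirr)
    have h2 : 1 * 1 ≤ π.natDegree * k := Nat.mul_le_mul hm1 hk1
    have : 1 ≤ a := by omega
    exact_mod_cast this

end Poly

/-! ## §3 The degree law (power-series residuals, surfaces) -/

section SeriesLaw

open MohWindowShadePS

variable {σ : Type*} {K : Type*} [Field K] [Fintype σ] [DecidableEq σ] [DecidableEq K]
variable (p : ℕ) [hp : Fact p.Prime] [CharP K p] {j i : σ}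

omit hp [CharP K p] in
/-- **[OURS · L1 W4.6] THE DEGREE LAW, power-series residuals** (by truncation transfer from `degree_mul_shade_step_le`). NOT a statement of
the manuscript. [cite: Hauser2010, §§F–G (point blowup followed by cleaning)] -/
theorem series_degree_mul_shade_step_le (hij : i ≠ j) (htwo : ∀ l, l = j ∨ l = i) (b : σ → K) (hbj : b j = 0) (hbi : b i ≠ 0)
    (S : Series σ K) {o : ℕ} (ho : S.F.order = o) (hlo : p < o) (hhi : o < 2 * p) (hdiv : Divides S.r S.F)
    (heq : S.IsEquimultiplePoint p j b) {o' : ℕ} (ho' : (S.step p j b).F.order = o') (ho'2 : o' < 2 * p)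
    {K₀ : Type*} [Field K₀] (ι : K₀ →+* K) (F₀ : MvPowerSeries σ K₀) (hF : S.F = MvPowerSeries.map ι F₀)
    {π : Polynomial K₀} (hirr : Irreducible π) (hsep : π.Separable) (ht : (π.map ι).IsRoot (b i)) :
    (π.natDegree : ℕ∞) * (S.step p j b).shade ≤ S.shade ∧ 1 ≤ S.shade := by
  have hA : Agree (3 * p) (S.trunc (3 * p)) S := agree_trunc _ S
  have hA' : Agree (3 * p - p) _ _ := hA.step p j b hbj ho (by omega)
  rw [← hA'.shade_eq ho' (by omega), ← hA.shade_eq ho (by omega)]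
  have hF' : (S.trunc (3 * p)).F = MvPolynomial.map ι (truncTot (3 * p) F₀) := by
    rw [Series.trunc_F, hF, truncTot_map]
  exact degree_mul_shade_step_le (p := p) hij htwo b hbj hbi (S.trunc (3 * p)) (hA.ordZero_eq ho (by omega)) hlo hhi
    (fun d hd => hA.le_of_mem_support hdiv hd (degree_lt_of_mem_support_truncTot hd))
    ((hA.isEquimultiplePoint_iff p j b hbj (by omega)).mpr heq) ι _ hF' hirr hsep ht

end SeriesLaw

end MohWindowShadeDegreeLaw

end Summit.ResolutionOfSingularities.ResolutionOfSingularities.Theorems.CampaignW46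

end
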